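import Summits.QuantumFields.YangMills.Theorems.BalabanUVNodesN26AtRecord8X
import Summits.QuantumFields.YangMills.Theorems.BalabanUVNodesN28AtRecord9
import Literature.MathematicalPhysics.QuantumFieldTheory.Balaban1983to89.Node00.Record9

/-!
# DAG node N26 — B4 «β-continuity» AT NODE 00's STAGE-9 RECORD `Node00.IsRecordOfRecord₉C` (def-T's `Node00/Record9.lean`, p420804):
# the (D4)-chain instance for `D₀ := datumOfRecord₉ F N θ h` BY NAME, the route supply's `YMDAG.UVSplit.N26_B4lit` at
# `Rec := IsRecordOfRecord₉C`, its refinement from the Stage-8 ∀-forms, and «N26 closes WITH N25» at the Stage-9 record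

Cell `pub-ymgap`, YM-PLAN Track A (HUMAN RULING D-0062), seat `pub-ymgap-dag-n26-a` (gen 4; -a = KNIT-BY-NAME); eleventh N26 companion
(`BalabanUVNodesN26BetaCont{,Record,Merged,FiniteRep,WallEnd}`, `…N26AtRecord8{,X}`, `…N26B4litAtRecord`, `…N26BetaContChiStep`, `…N26FiniteVolumeCPt`).
STATUS OF RECORD: N26 = binder B4 is DEPENDENT on (D4) and VACATED in the discharge form of record (closes WITH B3 = N25, NODE O); instance 0∕1.

WHAT STAGE 9 IS FOR N26.  `Record9` replaces the density tower by the represented tower of record, but its β-functions of record ARE Stage 8's: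
`betaOfRecord₉ F N θ := betaOfRecord₈ F N θ.toStage8Params` (`abbrev`), `(datumOfRecord₉ F N θ h).βfun = betaOfRecord₉ F N θ` (`Node00.βfun_datumOfRecord₉`,
`rfl`), and every run's flow is `genFlow (betaOfRecord₉ F N θ) p.g0` (`Node00.flow_datumOfRecord₉`, `rfl`) — the SAME flows as the Stage-8 datum of
`θ.toStage8Params` (`Node00.flow_stage8`).  N26 reads the pair `(D, w)` ONLY through `D.βfun` (and the socket inputs through `w.γ`), N25's END reads `D.C`
ONLY through its flows; hence every ₉ fact below is the landed ₈ fact at `θ.toStage8Params`, composed BY NAME — the `βfun` bridge is dag-n28-a's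
`N28AtRecord9.βfun_datumOfRecord₉_eq_stage8` (p421831), IMPORTED, not re-derived (dag-lead DEDUP №26 (i)):
* §0 bridges: `endpointExistence_congr` (END reads a construction only through its flows), `flow_toB12_datumOfRecord₉_eq_stage8`,
  `endpointExistence_datumOfRecord₉_iff_stage8` (N25's END at the ₉ datum ↔ at the ₈ datum of `θ.toStage8Params`), `betaContH_datumOfRecord₉_iff_stage8`,
  `betaContH_datumOfRecord₉_iff` (B4 at the ₉ datum IS per-`k` history-continuity of the MERGED β of record on the box, `γc ≤ θ.γ`).
* §1 `n26_datumOfRecord₉` — N26's literal at the ₉ datum from the (D4) socket inputs for θ's OWN merged term family (gen 2's `n26_datumOfRecord₈` at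
  `θ.toStage8Params`); `n26_of_isRecordOfRecord₉C` — the record-PREDICATE form (box = the world's window `]0, w.γ]`, whose positivity and cap `w.γ ≤ θ.γ` are
  clauses of the predicate; the chart clause of record is INSIDE Stage-9 admissibility, `Stage9Params.Admissible.chart`, so chair R445 (A)(a2)'s «displayed
  non-degenerate chart» is honoured by the predicate itself).
* §2 `n26_B4lit_rec9C` — THE ∀-FORM OF RECORD at Stage 9: `N26_B4lit (IsRecordOfRecord₉C …)` from §1's socket inputs asked of every admissible θ with provisos.
* §3 the refinement from Stage 8 WITHOUT re-keying: `n26_B4lit_of_betaShadow` (a shadow at ANY world with the same `βfun` suffices — N26's conclusion does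
  not read the world), `exists_rec8X_βfun_eq_of_isRecordOfRecord₉C` (every ₉C record has a CHARTED Stage-8 record `IsRecordOfRecord₈X` with the same `βfun`
  and the same window: `θ.toStage8Params` at a fresh world, `Node00.exists_world_isRecordOfRecord₈X` — NOT at the ₉ world, whose construction is the
  represented tower's: `IsRecordOfRecord₉C ↛ IsRecordOfRecord₈X` at the datum, located by dag-n23-a in `Record9` §7), `n26_B4lit_rec9C_of_rec8X`,
  `n26_B4lit_rec9C_of_rec8C` (whoever closes the ₈X resp. ₈C ∀-form closes the ₉C one).
* §4 «N26 closes WITH N25» at Stage 9: `endpoint_and_n26_datumOfRecord₉` (row (D1)'s residue pinned on the record's one-loop object + the socket inputs ⇒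
  `EndpointExistence D₀.C.toB12 ∧ ∃ γc > 0, BetaContH γc D₀.βfun`, = gen 2's `endpoint_and_n26_datumOfRecord₈` through the two §0 iff's),
  `endpoint_and_n26_of_isRecordOfRecord₉C` (predicate form, ONE pin in the channel `(0, 1)`), `s_N25_and_n26_B4lit_rec9C` (the route literals
  `YMDAG.UVSplit.S_N25 ∧ YMDAG.UVSplit.N26_B4lit` at `Rec := IsRecordOfRecord₉C` from ONE (D1)+(D4) input package per admissible θ).

RIDER OF RECORD №6 — β-VERSION (director-ym LINE №44∕№45 (2); dag-ref-D READ #61 ∕ READ-OF-RECORD on this seat's [LOCATED-B4-VERSION ∕ -RSTEP], READ #72;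
def-T ERRATUM-VERSION, pub-ymgap INBOX l.10987): β here = `betaOfRecord₉ = betaOfRecord₈ ∘ toStage8Params`, read through the Stage-5 Radon–Nikodym ∕
`condKernel` transport of record and the `RkOfRecord`-keyed `chi7` — a VERSION-valued reading ((2): second derivatives at a point of an `rnDeriv`
representative) carrying the R-STEP hazard ((3): the (C-pt) input is asked of a family reading a ℕ-valued step function of the last coupling,
`BalabanUVNodesN26BetaContChiStep.not_continuousOn_RkOfRecord`); NO β-side binder is booked at Stage 9 over it, and the socket inputs below are AT HAZARD of
unsatisfiability at every admissible θ with `ν.r ≥ 1`; the repair of record rides in def-T's `betaOfRecord₉c` (continuous-version transport `TcOfRecord` +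
def-χ's fixed-threshold `chiFixed7`, INTENT-4 `Node00/ContinuousTransportOfRecord.lean`) ∕ the successor record per №44∕№45 (2) and plan g62 l.10990 — where
the SAME socket (`BalabanUVNodesN26Merged.n26lit_betaOfMerged_of_localizedRep`, generic in the merged family) instantiates by substitution.

HONEST FRAMING.  Count-neutral bookkeeping by name for a VACATED binder; no definition, no estimate, 0 `sorry`.  Every socket input (`P0 ∕ hβ0 ∕ hP0 ∕ A1 ∕
hrep ∕ hleaves ∕ (C-pt)`, the side conditions, the (D1) residue and pin) is a located hypothesis of NODE O ∕ row (D1) about the record's OWN term family —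
INSTANCE 0∕1; `IsRecordOfRecord₉C` is not junk-inhabited (K0 `Record9Inhabited` is analytic: the displayed provisos), so the ∀-forms here are NOT-A-DISCHARGE
(INHABITED-AT-₉C guard, LINE №45 (3)); N25 ∕ N26 NOT discharged; nothing of Bałaban's β asserted.  One finite four-torus programme at fixed ε per run — NOT
the continuum limit, NOT ℝ⁴, NOT infinite volume, NOT OS, NOT a mass gap, NOT Clay.
Sources (context): [I] = [Balaban1987RG1] T. Bałaban, Commun. Math. Phys. **109** (1987) 249–301: Thm 2 p. 259, (0.17)–(0.20) pp. 255–256, (1.7) p. 261,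
(1.20)–(1.22) p. 264, (5.10) p. 293; [II] = [Balaban1988RG2Cluster] Commun. Math. Phys. **116** (1988) 1–22: Lemma 3 (2.38) p. 20; [Balaban1989LargeFieldII]
Commun. Math. Phys. **122** (1989) 355–392: Thm 1 p. 355.
-/

noncomputable section

open scoped Matrix.Norms.L2Operator

namespace Summit.QuantumFields.YangMills.Theorems.BalabanUVNodesN26AtRecord9

open Literature.MathematicalPhysics.QuantumFieldTheory.Balaban1983to89
open Literature.MathematicalPhysics.QuantumFieldTheory.Balaban1983to89.FlowStep
open Literature.MathematicalPhysics.QuantumFieldTheory.Balaban1983to89.DagBinding (EndpointExistence WorldP)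
open Literature.MathematicalPhysics.QuantumFieldTheory.Balaban1983to89.T4Continuum (T4Family FiniteEpsData)
open Literature.MathematicalPhysics.QuantumFieldTheory.Balaban1983to89.Node00
open Literature.MathematicalPhysics.QuantumFieldTheory.Balaban1983to89.B13ScaleTransfer (Pt)
open Literature.MathematicalPhysics.QuantumFieldTheory.Balaban1983to89.Beta.RemainderChainLattice
open Literature.MathematicalPhysics.QuantumFieldTheory.Balaban1983to89.Beta.RemainderLimitTorus (LDom limKernel)
open Literature.MathematicalPhysics.QuantumFieldTheory.Balaban1983to89.Beta.RemainderDecay190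
open Literature.MathematicalPhysics.QuantumFieldTheory.Balaban1983to89.Beta.RemainderLocalityHolo (PolLeavesTFac190H)
open Literature.MathematicalPhysics.QuantumFieldTheory.Balaban1983to89.Beta.OneStepKernelFamily (TbalOf)
open Literature.MathematicalPhysics.QuantumFieldTheory.Balaban1983to89.Beta.OneStepResolventKernel (JetData)
open Summit.QuantumFields.BalabanUV.Gaps
open Summit.QuantumFields.YangMills.Theorems.BalabanUVNodesN26AtRecord8
  (betaContH_datumOfRecord₈_iff n26_datumOfRecord₈ endpoint_and_n26_datumOfRecord₈ endpoint_and_n26_datumOfRecord₈_onePin)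
open Summit.QuantumFields.YangMills.Theorems.BalabanUVNodesN26AtRecord8X (n26_B4lit_mono n26_B4lit_rec8X_of_rec8C)
open Summit.QuantumFields.YangMills.BalabanUVNodes.N28AtRecord9 (βfun_datumOfRecord₉_eq_stage8)
open Filter Topology

/-! ## §0 Bridges: END reads only flows; the Stage-9 datum has the Stage-8 datum's flows and β-functions -/

section Bridges

/-- END (`DagBinding.EndpointExistence C`) reads a small-field construction ONLY through its coupling flows `(C P).flow`: constructions with the same
flows have the same endpoint-existence statement. [folklore] -/
theorem endpointExistence_congr {C C' : B12.Construction} (h : ∀ P : B12.RunParams, (C P).flow = (C' P).flow) :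
    EndpointExistence C ↔ EndpointExistence C' := by
  unfold EndpointExistence
  simp only [h]

variable (F : T4Family) (N : ℕ) [NeZero N]

/-- **The Stage-9 datum's runs have THE SAME FLOWS as the Stage-8 datum's of `θ.toStage8Params`**: both are `genFlow` of `betaOfRecord₈ F N θ.toStage8Params`
from the bare coupling (`Node00.flow_datumOfRecord₉`, `Node00.flow_stage8`, both `rfl`) — the represented tower re-points the densities, not the flow.
[cite: Balaban1987RG1, (0.17)-(0.20) pp.255-256 (bookkeeping)] -/
theorem flow_toB12_datumOfRecord₉_eq_stage8 (θ : Stage9Params F N) (h : θ.Provisos) (P : B12.RunParams) :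
    ((datumOfRecord₉ F N θ h).C.toB12 P).flow = ((datumOfRecord₅ F N (θ.toStage8Params.toStage5 F N)).C.toB12 P).flow := by
  show ((datumOfRecord₉ F N θ h).C P).flow = ((datumOfRecord₅ F N (θ.toStage8Params.toStage5 F N)).C P).flow
  rw [flow_datumOfRecord₉, flow_stage8]

/-- **N25's END AT THE STAGE-9 DATUM ↔ AT THE STAGE-8 DATUM of `θ.toStage8Params`** (same flows; `endpointExistence_congr`).  So every landed Stage-8 road
to `EndpointExistence` transports to Stage 9 verbatim, and the tower∕transport re-point of `Record9` does not touch binder B3's END face.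
[cite: Balaban1987RG1, Thm 2 p.259 (first sentence; bookkeeping)] -/
theorem endpointExistence_datumOfRecord₉_iff_stage8 (θ : Stage9Params F N) (h : θ.Provisos) :
    EndpointExistence (datumOfRecord₉ F N θ h).C.toB12 ↔
      EndpointExistence (datumOfRecord₅ F N (θ.toStage8Params.toStage5 F N)).C.toB12 :=
  endpointExistence_congr (flow_toB12_datumOfRecord₉_eq_stage8 F N θ h)

/-- **B4 on a box `γc` AT THE STAGE-9 DATUM ↔ AT THE STAGE-8 DATUM of `θ.toStage8Params`** (both `βfun`s are `betaOfRecord₈ F N θ.toStage8Params`: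
dag-n28-a's bridge `N28AtRecord9.βfun_datumOfRecord₉_eq_stage8` BY NAME). [cite: Balaban1987RG1, (1.20)-(1.22) p.264 (bookkeeping)] -/
theorem betaContH_datumOfRecord₉_iff_stage8 (θ : Stage9Params F N) (h : θ.Provisos) (γc : ℝ) :
    BetaContH γc (datumOfRecord₉ F N θ h).βfun ↔ BetaContH γc (datumOfRecord₅ F N (θ.toStage8Params.toStage5 F N)).βfun := by
  rw [βfun_datumOfRecord₉_eq_stage8]

/-- **WHAT B4 IS AT THE STAGE-9 DATUM OF RECORD**: on a box `γc ≤ θ.γ`, `BetaContH γc (datumOfRecord₉ F N θ h).βfun` IS per-`k` history-continuity of the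
MERGED β of record `betaMerged F (mergedTermFamilyMat F N (chi7 F N θ.toStage8Params) θ.εbg) θ.ρ8 θ.bV k` on `]0, γc]^{k+1}` (gen 2's
`betaContH_datumOfRecord₈_iff` at `θ.toStage8Params`, through `betaContH_datumOfRecord₉_iff_stage8`).  RIDER №6: a version-valued reading at Stage 9.
[cite: Balaban1987RG1, (1.20)-(1.22) p.264] -/
theorem betaContH_datumOfRecord₉_iff (θ : Stage9Params F N) (h : θ.Provisos) {γc : ℝ} (hle : γc ≤ θ.γ) :
    BetaContH γc (datumOfRecord₉ F N θ h).βfun ↔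
      letI := θ.instVβ₁; letI := θ.instVβ₂; letI := θ.instιβ
      ∀ k, ContinuousOn (betaMerged F (mergedTermFamilyMat F N (chi7 F N θ.toStage8Params) θ.εbg) θ.ρ8 θ.bV k) (Box γc k) := by
  rw [betaContH_datumOfRecord₉_iff_stage8]
  exact betaContH_datumOfRecord₈_iff F N θ.toStage8Params hle

end Bridges

/-! ## §1 N26 at the Stage-9 datum and at a Stage-9 record, from the (D4) socket inputs -/

section AtRecord

variable (F : T4Family) (N : ℕ) [NeZero N]

/-- **N26 AT THE STAGE-9 DATUM OF RECORD** `datumOfRecord₉ F N θ hP` from the (D4) socket inputs FOR θ's OWN merged term family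
`mergedTermFamilyMat F N (chi7 F N θ.toStage8Params) θ.εbg`, chart `θ.ρ8 ∕ θ.bV` and one-loop object `beta0OfMerged … θ.v₀`, on a box `0 < γ₀ ≤ θ.γ`:
`hβ0` (the one-loop object IS the second moment of a coupling-free kernel `P0 k`), `hP0` ((5.10) for `P0 k`), the leaf kernels `A1`, `hrep` (the merged limit
kernel splits as `P0 + Σ'_Y A1`), `hleaves` ([II]-(2.38)∕(190) records), the side conditions, (C-pt) ⟹ `∃ γc > 0, BetaContH γc D₀.βfun` — gen 2's
`n26_datumOfRecord₈` at `θ.toStage8Params` through `betaContH_datumOfRecord₉_iff_stage8`.  Every input a located hypothesis of NODE O (RIDER №6: at hazard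
at Stage 9 as typed); instance 0∕1; N26 NOT discharged (VACATED, closes WITH N25).
[cite: Balaban1987RG1, (1.7) p.261, (1.20)-(1.22) p.264 and (5.10) p.293; Balaban1988RG2Cluster, Lemma 3 (2.38) p.20] -/
theorem n26_datumOfRecord₉ (θ : Stage9Params F N) (hP : θ.Provisos) {γ₀ : ℝ} (hγ₀ : 0 < γ₀) (hle : γ₀ ≤ θ.γ) {M : ℕ} [NeZero M]
    {c : B13.Consts} {ℓ α₂ : ℝ} {q : Consts190} (P0 : ℕ → Pt 4 → ℝ)
    (hβ0 : letI := θ.instVβ₁; letI := θ.instVβ₂; letI := θ.instιβ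
      ∀ k, beta0OfMerged (betaMerged F (mergedTermFamilyMat F N (chi7 F N θ.toStage8Params) θ.εbg) θ.ρ8 θ.bV) θ.v₀ k =
        B12Beta.secondMoment (fun _ _ => P0 k) 0 1)
    (hP0 : ∀ k, ∃ C δ₁ : ℝ, 0 < δ₁ ∧ B12Sec2to5.Decay510 (P0 k) C δ₁)
    (A1 : (k : ℕ) → (Fin (k + 1) → ℝ) → LDom 4 → Pt 4 → ℝ)
    (hrep : letI := θ.instVβ₁; letI := θ.instVβ₂; letI := θ.instιβ
      ∀ k (p : Fin (k + 1) → ℝ), p ∈ Box γ₀ k → ∀ z : Pt 4,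
        polLimit F (k + 1) (fun K => mergedTermFamilyMat F N (chi7 F N θ.toStage8Params) θ.εbg k p K) θ.ρ8 θ.bV 0 1 z =
          P0 k z + limKernel (A1 k p) z)
    (hleaves : ∀ k (p : Fin (k + 1) → ℝ), p ∈ Box γ₀ k → PolLeavesTFac190H 4 M (A1 k p) c ℓ α₂ q)
    (hC : CondsL 4 c ℓ) (h22 : c.R22gen ℓ) (hq : q.Valid c.δ₀) (hs : SignsL c α₂ q.B₃)
    (hcont : letI := θ.instVβ₁; letI := θ.instVβ₂; letI := θ.instιβ
      ∀ k (z : Pt 4), ContinuousOn (fun p : Fin (k + 1) → ℝ =>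
        polLimit F (k + 1) (fun K => mergedTermFamilyMat F N (chi7 F N θ.toStage8Params) θ.εbg k p K) θ.ρ8 θ.bV 0 1 z) (Box γ₀ k)) :
    ∃ γc : ℝ, 0 < γc ∧ BetaContH γc (datumOfRecord₉ F N θ hP).βfun := by
  obtain ⟨γc, hγc, hB⟩ :=
    n26_datumOfRecord₈ F N θ.toStage8Params hγ₀ hle P0 hβ0 hP0 A1 hrep hleaves hC h22 hq hs hcont
  exact ⟨γc, hγc, (betaContH_datumOfRecord₉_iff_stage8 F N θ hP γc).mpr hB⟩

/-- **N26 AT A STAGE-9 RECORD `(D, w)`** (`Node00.IsRecordOfRecord₉C F N D w`, predicate form): the box is the binding world's own small-coupling window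
`]0, w.γ]` — `0 < w.γ ∧ w.γ ≤ θ.γ` is a CLAUSE OF THE RECORD PREDICATE, so neither `0 < γ₀` nor the cap is an extra hypothesis — and the socket inputs are
asked of EVERY admissible θ (WITH PROVISOS) whose Stage-9 datum is `D`; Stage-9 admissibility CARRIES the chart clause of record with `0 < θ.cβ`
(`Stage9Params.Admissible.chart`), so the inputs are asked only of charted θ, as chair R445 (A)(a2) wants.  Conclusion: N26's literal at the record.
Every input a located hypothesis of NODE O (RIDER №6); instance 0∕1; N26 NOT discharged.
[cite: Balaban1987RG1, (1.20)-(1.22) p.264; Balaban1988RG2Cluster, Lemma 3 (2.38) p.20] -/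
theorem n26_of_isRecordOfRecord₉C {D : FiniteEpsData F (Matrix.specialUnitaryGroup (Fin N) ℂ)} {w : WorldP}
    (h : IsRecordOfRecord₉C F N D w)
    (hin : ∀ (θ : Stage9Params F N) (hP : θ.Provisos), θ.Admissible → D = datumOfRecord₉ F N θ hP → w.γ ≤ θ.γ →
      letI := θ.instVβ₁; letI := θ.instVβ₂; letI := θ.instιβ
      ∃ (M : ℕ) (_ : NeZero M) (c : B13.Consts) (ℓ α₂ : ℝ) (q : Consts190) (P0 : ℕ → Pt 4 → ℝ)
        (A1 : (k : ℕ) → (Fin (k + 1) → ℝ) → LDom 4 → Pt 4 → ℝ),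
        (∀ k, beta0OfMerged (betaMerged F (mergedTermFamilyMat F N (chi7 F N θ.toStage8Params) θ.εbg) θ.ρ8 θ.bV) θ.v₀ k =
          B12Beta.secondMoment (fun _ _ => P0 k) 0 1) ∧
        (∀ k, ∃ C δ₁ : ℝ, 0 < δ₁ ∧ B12Sec2to5.Decay510 (P0 k) C δ₁) ∧
        (∀ k (p : Fin (k + 1) → ℝ), p ∈ Box w.γ k → ∀ z : Pt 4,
          polLimit F (k + 1) (fun K => mergedTermFamilyMat F N (chi7 F N θ.toStage8Params) θ.εbg k p K) θ.ρ8 θ.bV 0 1 z =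
            P0 k z + limKernel (A1 k p) z) ∧
        (∀ k (p : Fin (k + 1) → ℝ), p ∈ Box w.γ k → Nonempty (PolLeavesTFac190H 4 M (A1 k p) c ℓ α₂ q)) ∧
        CondsL 4 c ℓ ∧ c.R22gen ℓ ∧ q.Valid c.δ₀ ∧ SignsL c α₂ q.B₃ ∧
        (∀ k (z : Pt 4), ContinuousOn (fun p : Fin (k + 1) → ℝ =>
          polLimit F (k + 1) (fun K => mergedTermFamilyMat F N (chi7 F N θ.toStage8Params) θ.εbg k p K) θ.ρ8 θ.bV 0 1 z)
          (Box w.γ k))) :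
    ∃ γc : ℝ, 0 < γc ∧ BetaContH γc D.βfun := by
  obtain ⟨θ, hP, hθ, hD, -, ⟨hγ0, hγle⟩, -, -⟩ := h
  obtain ⟨M, _, c, ℓ, α₂, q, P0, A1, hβ0, hP0, hrep, hleaves, hC, h22, hq, hs, hcont⟩ := hin θ hP hθ hD hγle
  subst hD
  exact n26_datumOfRecord₉ F N θ hP hγ0 hγle P0 hβ0 hP0 A1 hrep (fun k p hp => Classical.choice (hleaves k p hp)) hC h22 hq hs
    hcont

end AtRecord

/-! ## §2 The route supply's `N26_B4lit` at `Rec := IsRecordOfRecord₉C` — the ∀-form of record at Stage 9 -/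

section Route

variable {N : ℕ} [NeZero N]

/-- **`N26_B4lit` AT THE STAGE-9 RECORD PREDICATE — THE ∀-FORM OF RECORD** (every F, every record pair, EVERY admissible θ with provisos realising the datum;
the chart of record is part of admissibility), from the (D4) socket inputs for θ's own merged term family (§1).  RIDER №6: over `betaOfRecord₉ =
betaOfRecord₈ ∘ toStage8Params` (a version-valued, `RkOfRecord`-χ reading) NO β-side binder is booked; the inputs re-point by substitution at def-T's
`betaOfRecord₉c`.  Instance 0∕1; NOT-A-DISCHARGE (INHABITED-AT-₉C guard); N26 NOT discharged.
[cite: Balaban1987RG1, (1.7) p.261 and (1.20)-(1.22) p.264; Balaban1988RG2Cluster, Lemma 3 (2.38) p.20] -/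
theorem n26_B4lit_rec9C
    (hin : ∀ (F : T4Family) (D : FiniteEpsData F (Matrix.specialUnitaryGroup (Fin N) ℂ)) (w : WorldP)
      (θ : Stage9Params F N) (hP : θ.Provisos), θ.Admissible → D = datumOfRecord₉ F N θ hP → w.γ ≤ θ.γ →
      letI := θ.instVβ₁; letI := θ.instVβ₂; letI := θ.instιβ
      ∃ (M : ℕ) (_ : NeZero M) (c : B13.Consts) (ℓ α₂ : ℝ) (q : Consts190) (P0 : ℕ → Pt 4 → ℝ)
        (A1 : (k : ℕ) → (Fin (k + 1) → ℝ) → LDom 4 → Pt 4 → ℝ),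
        (∀ k, beta0OfMerged (betaMerged F (mergedTermFamilyMat F N (chi7 F N θ.toStage8Params) θ.εbg) θ.ρ8 θ.bV) θ.v₀ k =
          B12Beta.secondMoment (fun _ _ => P0 k) 0 1) ∧
        (∀ k, ∃ C δ₁ : ℝ, 0 < δ₁ ∧ B12Sec2to5.Decay510 (P0 k) C δ₁) ∧
        (∀ k (p : Fin (k + 1) → ℝ), p ∈ Box w.γ k → ∀ z : Pt 4,
          polLimit F (k + 1) (fun K => mergedTermFamilyMat F N (chi7 F N θ.toStage8Params) θ.εbg k p K) θ.ρ8 θ.bV 0 1 z =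
            P0 k z + limKernel (A1 k p) z) ∧
        (∀ k (p : Fin (k + 1) → ℝ), p ∈ Box w.γ k → Nonempty (PolLeavesTFac190H 4 M (A1 k p) c ℓ α₂ q)) ∧
        CondsL 4 c ℓ ∧ c.R22gen ℓ ∧ q.Valid c.δ₀ ∧ SignsL c α₂ q.B₃ ∧
        (∀ k (z : Pt 4), ContinuousOn (fun p : Fin (k + 1) → ℝ =>
          polLimit F (k + 1) (fun K => mergedTermFamilyMat F N (chi7 F N θ.toStage8Params) θ.εbg k p K) θ.ρ8 θ.bV 0 1 z)
          (Box w.γ k))) :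
    YMDAG.UVSplit.N26_B4lit (fun F D w => IsRecordOfRecord₉C F N D w) :=
  fun F D w h => n26_of_isRecordOfRecord₉C F N h (hin F D w)

end Route

/-! ## §3 The refinement from the Stage-8 ∀-forms, through a β-shadow at a fresh world -/

section Shadow

variable (F : T4Family) (N : ℕ) [NeZero N]

/-- **EVERY STAGE-9 RECORD HAS A CHARTED STAGE-8 RECORD WITH THE SAME β-FUNCTIONS AND THE SAME WINDOW**: for `(D, w)` with ₉C witness θ, the Stage-8
datum of `θ.toStage8Params` (Stage-8 admissible, `Admissible.toStage8`; charted with `0 < θ.cβ`, `Admissible.chart`) at a FRESH world of window `w.γ`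
(`Node00.exists_world_isRecordOfRecord₈X`) is a ₈X record, and its `βfun` is `D`'s (dag-n28-a's `N28AtRecord9.βfun_datumOfRecord₉_eq_stage8`).  NOT the ₉
world itself: its construction is the represented tower's, `IsRecordOfRecord₉C ↛ IsRecordOfRecord₈X` at the datum (dag-n23-a, `Record9` §7).
[cite: Balaban1989LargeFieldII, Thm 1 + (0.1) pp.355-356; Balaban1987RG1, (1.20)-(1.22) p.264 (bookkeeping)] -/
theorem exists_rec8X_βfun_eq_of_isRecordOfRecord₉C {D : FiniteEpsData F (Matrix.specialUnitaryGroup (Fin N) ℂ)} {w : WorldP}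
    (h : IsRecordOfRecord₉C F N D w) :
    ∃ (D' : FiniteEpsData F (Matrix.specialUnitaryGroup (Fin N) ℂ)) (w' : WorldP),
      IsRecordOfRecord₈X F N D' w' ∧ D'.βfun = D.βfun ∧ w'.γ = w.γ := by
  obtain ⟨θ, hP, hθ, hD, -, hγ, -, -⟩ := h
  obtain ⟨w', hw', hγ'⟩ :=
    exists_world_isRecordOfRecord₈X F N θ.toStage8Params hθ.toStage8 hθ.chart.1 hθ.chart.2 hγ
  subst hD
  exact ⟨_, w', hw', (βfun_datumOfRecord₉_eq_stage8 θ hP).symm, hγ'⟩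

variable {F N}

/-- **β-SHADOW TRANSFER for the route's `N26_B4lit`, ANY world**: N26's conclusion `∃ γc > 0, BetaContH γc D.βfun` reads neither the world nor anything of
`D` but `βfun` — so if every `Rec`-record `(D, w)` has SOME `Rec'`-record `(D', w')` with `D'.βfun = D.βfun`, then `N26_B4lit Rec'` gives `N26_B4lit Rec`
(gen 3's `n26_B4lit_of_shadow` asked for the same world; not needed). [cite: Balaban1987RG1, (1.22) p.264 (bookkeeping)] -/
theorem n26_B4lit_of_betaShadow {Rec Rec' : YMDAG.UVSplit.RecordPred N}
    (hsh : ∀ (F : T4Family) (D : FiniteEpsData F (Matrix.specialUnitaryGroup (Fin N) ℂ)) (w : WorldP), Rec F D w →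
      ∃ (D' : FiniteEpsData F (Matrix.specialUnitaryGroup (Fin N) ℂ)) (w' : WorldP), Rec' F D' w' ∧ D'.βfun = D.βfun)
    (h26 : YMDAG.UVSplit.N26_B4lit Rec') : YMDAG.UVSplit.N26_B4lit Rec := fun F D w hw => by
  obtain ⟨D', w', h', hβ⟩ := hsh F D w hw
  rw [← hβ]
  exact h26 F D' w' h'

/-- **WHOEVER CLOSES THE CHARTED STAGE-8 ∀-FORM CLOSES THE STAGE-9 ONE**: `N26_B4lit (IsRecordOfRecord₈X …) → N26_B4lit (IsRecordOfRecord₉C …)`, by the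
β-shadow (`exists_rec8X_βfun_eq_of_isRecordOfRecord₉C`, `n26_B4lit_of_betaShadow`) — no re-keying of gen 3's `n26_B4lit_rec8X`.
[cite: Balaban1987RG1, (1.22) p.264 (bookkeeping)] -/
theorem n26_B4lit_rec9C_of_rec8X (h : YMDAG.UVSplit.N26_B4lit (fun F D w => IsRecordOfRecord₈X F N D w)) :
    YMDAG.UVSplit.N26_B4lit (fun F D w => IsRecordOfRecord₉C F N D w) :=
  n26_B4lit_of_betaShadow (fun F _ _ hw => by
    obtain ⟨D', w', h', hβ, -⟩ := exists_rec8X_βfun_eq_of_isRecordOfRecord₉C F N hw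
    exact ⟨D', w', h', hβ⟩) h

/-- … hence also from the UNCHARTED Stage-8 ∀-form (`n26_B4lit_rec8X_of_rec8C`): ₉C closers ≤ ₈X closers ≤ ₈C closers.
[cite: Balaban1987RG1, (1.22) p.264 (bookkeeping)] -/
theorem n26_B4lit_rec9C_of_rec8C (h : YMDAG.UVSplit.N26_B4lit (fun F D w => IsRecordOfRecord₈C F N D w)) :
    YMDAG.UVSplit.N26_B4lit (fun F D w => IsRecordOfRecord₉C F N D w) :=
  n26_B4lit_rec9C_of_rec8X (n26_B4lit_rec8X_of_rec8C h)

end Shadow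

/-! ## §4 «N26 closes WITH N25» at Stage 9: END ∧ B4 from one (D1)+(D4) package -/

section WithN25

variable (F : T4Family) (N : ℕ) [NeZero N]

/-- **N25's END ∧ N26 AT THE STAGE-9 DATUM OF RECORD** — «B4 closes WITH B3» at `D₀ := datumOfRecord₉ F N θ hP`: row (D1)'s residue
`Gaps.D1Residue.Residue Lc Js Nc μ ν` with its identification pinned ON THE RECORD's ONE-LOOP OBJECT (`hβ`), the socket inputs at the one-loop slope
`ε₁·K_rem,L ≤ stepBal Nc Lc`, `0 < γ₀ ≤ θ.γ` ⟹ `EndpointExistence D₀.C.toB12 ∧ ∃ γc > 0, BetaContH γc D₀.βfun` — gen 2's `endpoint_and_n26_datumOfRecord₈` at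
`θ.toStage8Params` through the two §0 bridges (same flows, same `βfun`).  Instance 0∕1 on rows (D1) and (D4) (RIDER №6); N25 ∕ N26 NOT discharged.
[cite: Balaban1987RG1, Thm 2 p.259 (first sentence) and (1.20)-(1.22) p.264; Balaban1988RG2Cluster, Lemma 3 (2.38) p.20] -/
theorem endpoint_and_n26_datumOfRecord₉ (θ : Stage9Params F N) (hP : θ.Provisos) {Lc : ℕ} [NeZero Lc] (Js : ℕ → JetData 3 Lc) {Nc : ℝ}
    {μ ν : Fin 4}
    (hβ : letI := θ.instVβ₁; letI := θ.instVβ₂; letI := θ.instιβ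
      ∀ j, beta0OfMerged (betaMerged F (mergedTermFamilyMat F N (chi7 F N θ.toStage8Params) θ.εbg) θ.ρ8 θ.bV) θ.v₀ j =
        B12Beta.secondMoment (TbalOf Lc Js j) μ ν)
    (h1 : D1Residue.Residue Lc Js Nc μ ν) {γ₀ : ℝ} (hγ₀ : 0 < γ₀) (hle : γ₀ ≤ θ.γ) {M : ℕ} [NeZero M]
    {c : B13.Consts} {ℓ α₂ : ℝ} {q : Consts190} (P0 : ℕ → Pt 4 → ℝ)
    (hβ0 : letI := θ.instVβ₁; letI := θ.instVβ₂; letI := θ.instιβ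
      ∀ k, beta0OfMerged (betaMerged F (mergedTermFamilyMat F N (chi7 F N θ.toStage8Params) θ.εbg) θ.ρ8 θ.bV) θ.v₀ k =
        B12Beta.secondMoment (fun _ _ => P0 k) 0 1)
    (hP0 : ∀ k, ∃ C δ₁ : ℝ, 0 < δ₁ ∧ B12Sec2to5.Decay510 (P0 k) C δ₁)
    (A1 : (k : ℕ) → (Fin (k + 1) → ℝ) → LDom 4 → Pt 4 → ℝ)
    (hrep : letI := θ.instVβ₁; letI := θ.instVβ₂; letI := θ.instιβ
      ∀ k (p : Fin (k + 1) → ℝ), p ∈ Box γ₀ k → ∀ z : Pt 4,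
        polLimit F (k + 1) (fun K => mergedTermFamilyMat F N (chi7 F N θ.toStage8Params) θ.εbg k p K) θ.ρ8 θ.bV 0 1 z =
          P0 k z + limKernel (A1 k p) z)
    (hleaves : ∀ k (p : Fin (k + 1) → ℝ), p ∈ Box γ₀ k → PolLeavesTFac190H 4 M (A1 k p) c ℓ α₂ q)
    (hC : CondsL 4 c ℓ) (h22 : c.R22gen ℓ) (hq : q.Valid c.δ₀) (hs : SignsL c α₂ q.B₃)
    (hsmall : c.ε₁ * remCoeffL 4 M c α₂ q.B₃ ≤ B12Normalization.stepBal Nc Lc)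
    (hcont : letI := θ.instVβ₁; letI := θ.instVβ₂; letI := θ.instιβ
      ∀ k (z : Pt 4), ContinuousOn (fun p : Fin (k + 1) → ℝ =>
        polLimit F (k + 1) (fun K => mergedTermFamilyMat F N (chi7 F N θ.toStage8Params) θ.εbg k p K) θ.ρ8 θ.bV 0 1 z) (Box γ₀ k)) :
    EndpointExistence (datumOfRecord₉ F N θ hP).C.toB12 ∧
      ∃ γc : ℝ, 0 < γc ∧ BetaContH γc (datumOfRecord₉ F N θ hP).βfun := by
  obtain ⟨hE, γc, hγc, hB⟩ := endpoint_and_n26_datumOfRecord₈ F N θ.toStage8Params Js hβ h1 hγ₀ hle P0 hβ0 hP0 A1 hrep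
    hleaves hC h22 hq hs hsmall hcont
  exact ⟨(endpointExistence_datumOfRecord₉_iff_stage8 F N θ hP).mpr hE, γc, hγc,
    (betaContH_datumOfRecord₉_iff_stage8 F N θ hP γc).mpr hB⟩

/-- **N25's END ∧ N26 AT A STAGE-9 RECORD `(D, w)`, predicate form, ONE PIN** (dag-ref-D N-n26-4: the (D1) road run in the β-layer's own channel `(0, 1)`,
one-loop kernels `P0 k := TbalOf Lc Js k 0 1`, so (D1)'s pin IS the socket's `hβ0`): the package is asked of EVERY admissible θ with provisos realising `D`,
on the world's window `]0, w.γ]` (gen 2's `endpoint_and_n26_datumOfRecord₈_onePin` at `θ.toStage8Params` + the §0 bridges).  Instance 0∕1 (RIDER №6);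
N25 ∕ N26 NOT discharged. [cite: Balaban1987RG1, Thm 2 p.259 (first sentence), (1.20)-(1.22) p.264 and (2.12)-(2.13) p.268; Balaban1988RG2Cluster, Lemma 3 (2.38) p.20] -/
theorem endpoint_and_n26_of_isRecordOfRecord₉C {D : FiniteEpsData F (Matrix.specialUnitaryGroup (Fin N) ℂ)} {w : WorldP}
    (h : IsRecordOfRecord₉C F N D w)
    (hin : ∀ (θ : Stage9Params F N) (hP : θ.Provisos), θ.Admissible → D = datumOfRecord₉ F N θ hP → w.γ ≤ θ.γ →
      letI := θ.instVβ₁; letI := θ.instVβ₂; letI := θ.instιβ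
      ∃ (Lc : ℕ) (_ : NeZero Lc) (Js : ℕ → JetData 3 Lc) (Nc : ℝ) (M : ℕ) (_ : NeZero M) (c : B13.Consts) (ℓ α₂ : ℝ)
        (q : Consts190) (A1 : (k : ℕ) → (Fin (k + 1) → ℝ) → LDom 4 → Pt 4 → ℝ),
        (∀ j, beta0OfMerged (betaMerged F (mergedTermFamilyMat F N (chi7 F N θ.toStage8Params) θ.εbg) θ.ρ8 θ.bV) θ.v₀ j =
          B12Beta.secondMoment (TbalOf Lc Js j) 0 1) ∧
        D1Residue.Residue Lc Js Nc 0 1 ∧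
        (∀ k, ∃ C δ₁ : ℝ, 0 < δ₁ ∧ B12Sec2to5.Decay510 (TbalOf Lc Js k 0 1) C δ₁) ∧
        (∀ k (p : Fin (k + 1) → ℝ), p ∈ Box w.γ k → ∀ z : Pt 4,
          polLimit F (k + 1) (fun K => mergedTermFamilyMat F N (chi7 F N θ.toStage8Params) θ.εbg k p K) θ.ρ8 θ.bV 0 1 z =
            TbalOf Lc Js k 0 1 z + limKernel (A1 k p) z) ∧
        (∀ k (p : Fin (k + 1) → ℝ), p ∈ Box w.γ k → Nonempty (PolLeavesTFac190H 4 M (A1 k p) c ℓ α₂ q)) ∧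
        CondsL 4 c ℓ ∧ c.R22gen ℓ ∧ q.Valid c.δ₀ ∧ SignsL c α₂ q.B₃ ∧
        c.ε₁ * remCoeffL 4 M c α₂ q.B₃ ≤ B12Normalization.stepBal Nc Lc ∧
        (∀ k (z : Pt 4), ContinuousOn (fun p : Fin (k + 1) → ℝ =>
          polLimit F (k + 1) (fun K => mergedTermFamilyMat F N (chi7 F N θ.toStage8Params) θ.εbg k p K) θ.ρ8 θ.bV 0 1 z)
          (Box w.γ k))) :
    EndpointExistence D.C.toB12 ∧ ∃ γc : ℝ, 0 < γc ∧ BetaContH γc D.βfun := by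
  obtain ⟨θ, hP, hθ, hD, -, ⟨hγ0, hγle⟩, -, -⟩ := h
  obtain ⟨Lc, _, Js, Nc, M, _, c, ℓ, α₂, q, A1, hβ, h1, hP0, hrep, hleaves, hC, h22, hq, hs, hsmall, hcont⟩ :=
    hin θ hP hθ hD hγle
  subst hD
  obtain ⟨hE, γc, hγc, hB⟩ := endpoint_and_n26_datumOfRecord₈_onePin F N θ.toStage8Params Js hβ h1 hγ0 hγle hP0 A1 hrep
    (fun k p hp => Classical.choice (hleaves k p hp)) hC h22 hq hs hsmall hcont
  exact ⟨(endpointExistence_datumOfRecord₉_iff_stage8 F N θ hP).mpr hE, γc, hγc,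
    (betaContH_datumOfRecord₉_iff_stage8 F N θ hP γc).mpr hB⟩

variable {F N}

/-- **«N26 CLOSES WITH N25» AT THE STAGE-9 RECORD PREDICATE**: the route literals `YMDAG.UVSplit.S_N25 Rec` (END at every record) AND
`YMDAG.UVSplit.N26_B4lit Rec` at `Rec := IsRecordOfRecord₉C`, BOTH from ONE (D1)-residue + (D4)-socket package asked of every admissible θ with provisos
(`endpoint_and_n26_of_isRecordOfRecord₉C`).  ∀-forms, NOT-A-DISCHARGE (INHABITED-AT-₉C guard; RIDER №6); N25 ∕ N26 NOT discharged.
[cite: Balaban1987RG1, Thm 2 p.259 (first sentence) and (1.20)-(1.22) p.264; Balaban1988RG2Cluster, Lemma 3 (2.38) p.20] -/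
theorem s_N25_and_n26_B4lit_rec9C
    (hin : ∀ (F : T4Family) (D : FiniteEpsData F (Matrix.specialUnitaryGroup (Fin N) ℂ)) (w : WorldP)
      (θ : Stage9Params F N) (hP : θ.Provisos), θ.Admissible → D = datumOfRecord₉ F N θ hP → w.γ ≤ θ.γ →
      letI := θ.instVβ₁; letI := θ.instVβ₂; letI := θ.instιβ
      ∃ (Lc : ℕ) (_ : NeZero Lc) (Js : ℕ → JetData 3 Lc) (Nc : ℝ) (M : ℕ) (_ : NeZero M) (c : B13.Consts) (ℓ α₂ : ℝ)
        (q : Consts190) (A1 : (k : ℕ) → (Fin (k + 1) → ℝ) → LDom 4 → Pt 4 → ℝ),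
        (∀ j, beta0OfMerged (betaMerged F (mergedTermFamilyMat F N (chi7 F N θ.toStage8Params) θ.εbg) θ.ρ8 θ.bV) θ.v₀ j =
          B12Beta.secondMoment (TbalOf Lc Js j) 0 1) ∧
        D1Residue.Residue Lc Js Nc 0 1 ∧
        (∀ k, ∃ C δ₁ : ℝ, 0 < δ₁ ∧ B12Sec2to5.Decay510 (TbalOf Lc Js k 0 1) C δ₁) ∧
        (∀ k (p : Fin (k + 1) → ℝ), p ∈ Box w.γ k → ∀ z : Pt 4,
          polLimit F (k + 1) (fun K => mergedTermFamilyMat F N (chi7 F N θ.toStage8Params) θ.εbg k p K) θ.ρ8 θ.bV 0 1 z =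
            TbalOf Lc Js k 0 1 z + limKernel (A1 k p) z) ∧
        (∀ k (p : Fin (k + 1) → ℝ), p ∈ Box w.γ k → Nonempty (PolLeavesTFac190H 4 M (A1 k p) c ℓ α₂ q)) ∧
        CondsL 4 c ℓ ∧ c.R22gen ℓ ∧ q.Valid c.δ₀ ∧ SignsL c α₂ q.B₃ ∧
        c.ε₁ * remCoeffL 4 M c α₂ q.B₃ ≤ B12Normalization.stepBal Nc Lc ∧
        (∀ k (z : Pt 4), ContinuousOn (fun p : Fin (k + 1) → ℝ =>
          polLimit F (k + 1) (fun K => mergedTermFamilyMat F N (chi7 F N θ.toStage8Params) θ.εbg k p K) θ.ρ8 θ.bV 0 1 z)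
          (Box w.γ k))) :
    YMDAG.UVSplit.S_N25 (fun F D w => IsRecordOfRecord₉C F N D w) ∧
      YMDAG.UVSplit.N26_B4lit (fun F D w => IsRecordOfRecord₉C F N D w) :=
  ⟨fun F D w h => (endpoint_and_n26_of_isRecordOfRecord₉C F N h (hin F D w)).1,
    fun F D w h => (endpoint_and_n26_of_isRecordOfRecord₉C F N h (hin F D w)).2⟩

end WithN25

end Summit.QuantumFields.YangMills.Theorems.BalabanUVNodesN26AtRecord9

end
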